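import Literature.AlgebraicGeometry.Frobenioids.Prop55SubRatStdRlfHolds
import Literature.AlgebraicGeometry.Frobenioids.Prop55SubRatStdSlotCounterexample
import Literature.AlgebraicGeometry.Frobenioids.ModelFrobenioidBirat
import HarnessLib

/-!
# Frobenioids I, Proposition 5.5 (iii)/(iv): the slots `Prop55iii_untr_rlf_ratStd` and `IsImageOfDivB` AT THE
# GENUINE INSTANCES (D-0079 L-F [FrdI/II], pack D: FACT rows F-2647 and F-2690 — instance forms with the FACT
# declaration as conclusion head)

Mochizuki, *The geometry of Frobenioids I: the general theory*, Kyushu J. Math. **62** (2008) 293–400, §5,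
Proposition 5.5 (iii) p. 104 ll. 37–39, verbatim: «Finally, suppose further that C is not of group-like type. Then
if C is of standard (respectively, rationally standard) type, then so are C^un-tr, C^rlf.»; Proposition 5.5 (iv)
p. 104 ll. 40–44, verbatim: «If C is the model Frobenioid associated to data Φ, B, Div_B : B → Φ^gp [cf. Theorem 5.2,
(ii)], then there is a natural equivalence of categories … between C^pf (respectively, C^un-tr; C^rlf) and the model
Frobenioid associated to the data Φ^pf, B^pf, B^pf → (Φ^gp)^pf (respectively, Φ, Φ^birat, Φ^birat ↪ Φ^gp; …)»;
Theorem 5.2 (ii) p. 101 ll. 12–18, verbatim: «Moreover, there is a natural isomorphism of functors between the functor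
"O^×(−)" on D associated to the Frobenioid C^birat [cf. Propositions 2.2, (ii), (iii); 4.4, (ii)] and the functor B;
this isomorphism is compatible with the homomorphisms O^×(−) → Φ^gp [cf. Proposition 4.4, (iii)], Div_B : B → Φ^gp.»
(whence the tree's slot wording "Φ^birat is the image of Div_B"). [doc-only v2: the v1 header put that TREE paraphrase
inside «…» — withdrawn (quote-voice rule); all declarations byte-identical] [cite: MochizukiFrdI2008, Prop. 5.5 (iii) p.104]
[cite: MochizukiFrdI2008, Prop. 5.5 (iv) p.104]

PROOF-ONLY file (cell abc-iut, D-0079 L-F sub-cell [FrdI/II], seat abc-iut-L1-d1 gen 5; `plan/L1/LF-FRD.tsv` pack D,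
RULES (a)–(e); conclusion head = the FACT declaration; 0 `def`, inputs BY NAME).

* F-2647 `FrdI.Prop55Sub.Prop55iii_untr_rlf_ratStd F hF hΦ Supp SuppR`: a slot with a FREE support binder `SuppR`
  on `Φ^rlf`, REFUTED as typed at the arithmetic Frobenioid for the degenerate `SuppR := ⊥` (abc-iut-w5-d250's
  `not_prop55iii_untr_rlf_ratStd_arith`, GAP P55iii-F1, class MISSTATED) and PROVED for EVERY Frobenioid at THE
  support `PrimarySupp` on both sides (abc-iut-L1-t2 lineage `prop55iii_untr_rlf_ratStd'_holds` on the repaired slot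
  `Prop55iii_untr_rlf_ratStd'`, which IS the slot at `Supp = SuppR = PrimarySupp` by `rfl`).  Recorded here with the
  ORIGINAL declaration as head: `FrdI.Prop55Sub.prop55iii_untr_rlf_ratStd_primarySupp` (every Frobenioid, THE
  support) and `…_primarySupp_arith` (at `C_{K/F}`).
* F-2690 `ModelFrobenioid.IsImageOfDivB Φ B DivB Ψ` (the tree's slot "`Ψ ⊆ Φ^gp` is the image of `Div_B`" of
  `ModelFrobenioidUntr.lean`): for THE rational-function subfunctor `Φ^birat` of a model Frobenioid with group-like
  `B` (Thm. 5.2's standing hypothesis) it HOLDS — abc-iut-L6-t10 lineage `isImageOfDivB_biratSubfunctor` —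
  recorded as `ModelFrobenioid.isImageOfDivB_biratSubfunctor_of_isGroupLike` and, at `C_{K/F}` (`B = (·)^×`,
  `unitsFunctor_isGroupLike`), `isImageOfDivB_arith`.
Honest framing: kernel bookkeeping of OUR typed renderings of a refereed 2008 statement; nothing here bears on, or
takes a side on, [IUTchIII] Cor. 3.12.
-/

namespace Literature.AlgebraicGeometry.Frobenioids

open CategoryTheory Opposite
open PreFrobenioid

universe w v v' u u'

/-! ### F-2647 at THE support, every Frobenioid -/

namespace FrdI.Prop55Sub

section General

variable {D : Type u} [Category.{v} D] {Φ : Dᵒᵖ ⥤ CommMonCat.{w}} {C : Type u'} [Category.{v'} C]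
  (F : C ⥤ ElemFrobenioid Φ)

/-- **[FrdI] Prop. 5.5 (iii), "Finally", rationally standard type — the instance form of F-2647 at THE support**:
for EVERY Frobenioid `C → F_Φ` with `Φ` perf-factorial, the slot `Prop55iii_untr_rlf_ratStd` with BOTH support
predicates the canonical `PrimarySupp` holds (it is `Prop55iii_untr_rlf_ratStd'`, proved by
`prop55iii_untr_rlf_ratStd'_holds`): `C` Frobenius-isotropic, Frobenius-normalized, not group-like and of rationally
standard type ⇒ so are `C^un-tr` and `C^rlf`. [cite: MochizukiFrdI2008, Prop. 5.5 (iii) p.104] -/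
theorem prop55iii_untr_rlf_ratStd_primarySupp (hF : IsFrobenioid F) (hΦ : IsPerfFactorialOn Φ) :
    Prop55iii_untr_rlf_ratStd F hF hΦ (fun a 𝔭 => PrimarySupp a 𝔭) (fun a 𝔭 => PrimarySupp a 𝔭) :=
  prop55iii_untr_rlf_ratStd'_holds F hF hΦ

end General

section Arith

variable (F : Type) [Field F] [NumberField F] (K : Type) [Field K] [Algebra F K] [IsGalois F K]

/-- **F-2647 at `C_{K/F}`, THE support**: for the arithmetic Frobenioid of Ex. 6.3 the slot holds with
`Supp = SuppR = PrimarySupp` — whereas with the degenerate free binder `SuppR := ⊥` it is refuted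
(`not_prop55iii_untr_rlf_ratStd_arith`, abc-iut-w5-d250): the row is a schema in `SuppR`, true at THE support.
[cite: MochizukiFrdI2008, Prop. 5.5 (iii) p.104] -/
theorem prop55iii_untr_rlf_ratStd_primarySupp_arith :
    Prop55iii_untr_rlf_ratStd
      (ModelFrobenioid.toElem (arithDivisorFunctor F K) (unitsFunctor F K) (divNatTrans F K))
      (arithFrobenioid_isFrobenioid F K) (arith_isPerfFactorialOn F K)
      (fun a 𝔭 => PrimarySupp a 𝔭) (fun a 𝔭 => PrimarySupp a 𝔭) :=
  prop55iii_untr_rlf_ratStd_primarySupp _ (arithFrobenioid_isFrobenioid F K) (arith_isPerfFactorialOn F K)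

end Arith

end FrdI.Prop55Sub

/-! ### F-2690 `IsImageOfDivB` for THE `Φ^birat` of a model Frobenioid -/

namespace ModelFrobenioid

section General

variable {D : Type u} [Category.{v} D] {Φ B : Dᵒᵖ ⥤ CommMonCat.{w}} {DivB : B ⟶ monoidGp Φ}

/-- **[FrdI] Thm. 5.2 (ii) / Prop. 5.5 (iv) — the instance form of F-2690**: for a model Frobenioid with group-like
rational-function monoid `B` (Thm. 5.2's standing hypothesis), THE subfunctor `Φ^birat ⊆ Φ^gp` is the image of
`Div_B` (`isImageOfDivB_biratSubfunctor`, abc-iut-L6-t10 lineage, fed with `IsGroupLike ⇒ IsUnit`).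
[cite: MochizukiFrdI2008, Prop. 5.5 (iv) p.104] -/
theorem isImageOfDivB_biratSubfunctor_of_isGroupLike (hBg : Objectwise (fun M _ => IsGroupLike M) B) :
    IsImageOfDivB Φ B DivB (PreFrobenioid.biratSubfunctor (toElem Φ B DivB)) :=
  isImageOfDivB_biratSubfunctor fun A b => (hBg (unop A)).isUnit b

end General

section Arith

variable (F : Type) [Field F] [NumberField F] (K : Type) [Field K] [Algebra F K] [IsGalois F K]

omit [IsGalois F K] in
/-- **F-2690 at `C_{K/F}`**: for the arithmetic Frobenioid of Ex. 6.3 (`B(Spec L) = L^×`, a group) THE subfunctor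
`Φ^birat` is the image of `Div_B`. [cite: MochizukiFrdI2008, Thm. 6.4 (i) p.114] -/
theorem isImageOfDivB_arith :
    IsImageOfDivB (arithDivisorFunctor F K) (unitsFunctor F K) (divNatTrans F K)
      (PreFrobenioid.biratSubfunctor
        (toElem (arithDivisorFunctor F K) (unitsFunctor F K) (divNatTrans F K))) :=
  isImageOfDivB_biratSubfunctor_of_isGroupLike (unitsFunctor_isGroupLike F K)

end Arith

end ModelFrobenioid

end Literature.AlgebraicGeometry.Frobenioids
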